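import Summits.BirchSwinnertonDyer.BirchSwinnertonDyer.Theorems.ThetaPartnerAtTwoSignedControlAtTwoPlusGenStepCurveTwo
import Summits.BirchSwinnertonDyer.BirchSwinnertonDyer.Theorems.ThetaPartnerAtTwoSignedKatoUpToAtTwoLocalTwoRealTrace
import HarnessLib

/-!
# The PLUS tower at `2`, X: the TRACE RELATION of the plus Honda points in two-term form
# `e_{m+1} + s·e_{m+1} + e_{m−1} ∈ E(ℚ₂)` (clause (TR) of HONDA⁺@2 in `Ω`-currency)
# (K4 `SignedControlAtTwo`, stmt-BirchSwinnertonDyer-20309, line `eulerchar` v6 — memo LAGPLUS-AT-2 §2, §7)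

Route `ThetaPartnerAtTwo` (TP2; shared with `ResidualThetaTransportAtTwo`), crux K4, lead seat `prover-bsd-wall-tp2-p3` (g2). Sequel of VII–IX.
INPUT: the K3 lead's `Δ`-twisted trace relation `…LocalTwoRealTrace.sum_act_add_sum_act_add_mem` (sums over `Stab ζ_{2^m}/Stab ζ_{2^{m+1}}`
of coset representatives). At `p = 2`, `m ≥ 1`, that quotient has TWO elements, so the coset sum of any right-`Stab ζ_{2^{m+1}}`-invariant
function is `f(1) + f(s)` for any `s ∈ Stab ζ_{2^m} ∖ Stab ζ_{2^{m+1}}` (§1); for the coordinatewise action on points of `L(ℚ₂(ζ_{2^{m+1}}))`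
this reads `∑_q act q̃ Q = Q + act s Q` (§2). Consequently (§3) the plus Honda points `e = c + σ·c` of file VII satisfy the TWO-TERM trace
relation **`e_{m+1} + act s e_{m+1} + e_{m−1} ∈ L(ℚ₂) = E(ℚ₂)`** — i.e. `Tr_{ℚ₂(v_{m+1})⁺-step} e_{m+1} = −e_{m−1} + S` with `S` rational
(the memo's `Tr e_n = −e_{n−2} − s`; with `d := 3e − 2S` the relation is exact) — for `W` itself under `GoodSS W 2`, `a₂(W) = 0`
(`plusPoint_trace_of_goodSS`).
HONEST FRAMING: THEOREMS ONLY (no definition, no named fact, no instance, no `sorry`); local theory at `2`; nothing about any Selmer group;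
closes no item; BSD is not proved by any of this.

References: [Kobayashi2003] Lemma 8.9; [KuriharaOtsuki2006] Prop. 1.4; [SerreLocalFields1979] Ch. IV §4.
-/

set_option autoImplicit false
-- the Theorems namespace of this sub repeats the summit name by design (D-0017 nested layout)
set_option linter.dupNamespace false

noncomputable section

open scoped Classical Topology NNReal IntermediateField
open Filter PowerSeries Finset Polynomial

namespace Summit.BirchSwinnertonDyer.BirchSwinnertonDyer.Theorems.SignedEC.PlusTower

open Literature.RingTheory.FormalGroups WeierstrassCurve Field Field.absoluteGaloisGroup
open Summit.BirchSwinnertonDyer.Rank1Residual.Additive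
open Summit.BirchSwinnertonDyer.Rank1Residual.Additive.PadicCyclotomicTower
open Summit.BirchSwinnertonDyer.Rank1Residual.Additive.BallEval
open Literature.NumberTheory.EllipticCurves Literature.NumberTheory.EllipticCurves.FormalGroupChart
open Literature.NumberTheory.EllipticCurves.Rank1Residual
open Summit.BirchSwinnertonDyer.BirchSwinnertonDyer.Theorems.SignedKatoOffTwo.LocalAllPrimes
open Summit.BirchSwinnertonDyer.BirchSwinnertonDyer.Theorems.SignedKatoOffTwo.LocalTwo

/-! ## §1 Coset sums over the two-element quotient `Stab ζ_{2^m} / Stab ζ_{2^{m+1}}` -/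

/-- `[Stab ζ_{2^m} : Stab ζ_{2^{m+1}}] = 2` for `m ≥ 1` (at `p = 2`). [cite: SerreLocalFields1979, Ch. IV §4] -/
theorem index_subgroupOf_stab_succ_two {m : ℕ} (hm : 1 ≤ m) : ((stab 2 (m + 1)).subgroupOf (stab 2 m)).index = 2 := by
  rw [index_subgroupOf_stab_succ, if_neg (by omega)]

/-- There is `s ∈ Stab ζ_{2^m} ∖ Stab ζ_{2^{m+1}}` (`m ≥ 1`). [folklore] -/
theorem exists_mem_stab_not_mem_succ {m : ℕ} (hm : 1 ≤ m) :
    ∃ s : absoluteGaloisGroup ℚ_[2], s ∈ stab 2 m ∧ s ∉ stab 2 (m + 1) := by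
  by_contra h
  push Not at h
  have htop : (stab 2 (m + 1)).subgroupOf (stab 2 m) = ⊤ := by
    rw [eq_top_iff]
    intro x _
    rw [Subgroup.mem_subgroupOf]
    exact h x x.2
  have := index_subgroupOf_stab_succ_two hm
  rw [htop, Subgroup.index_top] at this
  exact absurd this (by norm_num)

/-- **A coset sum over the two-element quotient is `f(1) + f(s)`** for a right-`Stab ζ_{2^{m+1}}`-invariant `f` and any
`s ∈ Stab ζ_{2^m} ∖ Stab ζ_{2^{m+1}}` (`m ≥ 1`). [folklore] -/
theorem sum_out_eq_add {A : Type*} [AddCommMonoid A] {m : ℕ} (hm : 1 ≤ m)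
    [Fintype (stab 2 m ⧸ (stab 2 (m + 1)).subgroupOf (stab 2 m))]
    (f : absoluteGaloisGroup ℚ_[2] → A)
    (hf : ∀ σ τ : absoluteGaloisGroup ℚ_[2], τ ∈ stab 2 (m + 1) → f (σ * τ) = f σ)
    {s : absoluteGaloisGroup ℚ_[2]} (hs : s ∈ stab 2 m) (hs' : s ∉ stab 2 (m + 1)) :
    ∑ q : stab 2 m ⧸ (stab 2 (m + 1)).subgroupOf (stab 2 m), f ((q.out : stab 2 m) : absoluteGaloisGroup ℚ_[2]) =
      f 1 + f s := by
  set a : stab 2 m ⧸ (stab 2 (m + 1)).subgroupOf (stab 2 m) := QuotientGroup.mk 1 with ha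
  set b : stab 2 m ⧸ (stab 2 (m + 1)).subgroupOf (stab 2 m) := QuotientGroup.mk ⟨s, hs⟩ with hb
  have hab : a ≠ b := by
    intro h
    rw [ha, hb, QuotientGroup.eq, inv_one, one_mul, Subgroup.mem_subgroupOf] at h
    exact hs' h
  have hcard : Fintype.card (stab 2 m ⧸ (stab 2 (m + 1)).subgroupOf (stab 2 m)) = 2 := by
    rw [← Nat.card_eq_fintype_card, ← Subgroup.index_eq_card]
    exact index_subgroupOf_stab_succ_two hm
  have huniv : ({a, b} : Finset (stab 2 m ⧸ (stab 2 (m + 1)).subgroupOf (stab 2 m))) = Finset.univ :=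
    Finset.eq_univ_of_card _ (by rw [Finset.card_pair hab, hcard])
  rw [← huniv, Finset.sum_pair hab]
  obtain ⟨t, ht⟩ := QuotientGroup.mk_out_eq_mul ((stab 2 (m + 1)).subgroupOf (stab 2 m)) (1 : stab 2 m)
  obtain ⟨t', ht'⟩ := QuotientGroup.mk_out_eq_mul ((stab 2 (m + 1)).subgroupOf (stab 2 m)) (⟨s, hs⟩ : stab 2 m)
  have htm : ((t : stab 2 m) : absoluteGaloisGroup ℚ_[2]) ∈ stab 2 (m + 1) := Subgroup.mem_subgroupOf.mp t.2
  have ht'm : ((t' : stab 2 m) : absoluteGaloisGroup ℚ_[2]) ∈ stab 2 (m + 1) := Subgroup.mem_subgroupOf.mp t'.2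
  rw [← ha] at ht
  rw [← hb] at ht'
  rw [ht, ht', one_mul, Subgroup.coe_mul]
  congr 1
  · have := hf 1 _ htm
    rwa [one_mul] at this
  · exact hf s _ ht'm

/-! ## §2 The coordinatewise action: multiplicativity, triviality of `Stab`, two-term coset sums -/

section Act

variable {M : WeierstrassCurve ℤ_[2]}

/-- A coordinatewise action is multiplicative: `act (στ) = act σ ∘ act τ`. [folklore] -/
theorem act_mul (act : absoluteGaloisGroup ℚ_[2] → (genFibΩ 2 M).toAffine.Point → (genFibΩ 2 M).toAffine.Point)
    (hact0 : ∀ σ, act σ 0 = 0)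
    (hact : ∀ σ (x y : PadicAlgCl 2) (h : (genFibΩ 2 M).toAffine.Nonsingular x y),
      ∃ h', act σ (Affine.Point.some x y h) = Affine.Point.some (σ • x) (σ • y) h')
    (σ τ : absoluteGaloisGroup ℚ_[2]) (Q : (genFibΩ 2 M).toAffine.Point) : act (σ * τ) Q = act σ (act τ Q) := by
  rcases Q with _ | ⟨x, y, h⟩
  · change act (σ * τ) 0 = act σ (act τ 0)
    rw [hact0, hact0, hact0]
  · obtain ⟨h1, e1⟩ := hact τ x y h
    obtain ⟨h2, e2⟩ := hact σ (τ • x) (τ • y) h1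
    obtain ⟨h3, e3⟩ := hact (σ * τ) x y h
    rw [e3, e1, e2]
    simp only [mul_smul]

/-- `Stab ζ_{2^n}` acts trivially on `L(ℚ₂(ζ_{2^n}))`. [folklore] -/
theorem act_eq_self_of_mem_stab
    (act : absoluteGaloisGroup ℚ_[2] → (genFibΩ 2 M).toAffine.Point → (genFibΩ 2 M).toAffine.Point)
    (hact0 : ∀ σ, act σ 0 = 0)
    (hact : ∀ σ (x y : PadicAlgCl 2) (h : (genFibΩ 2 M).toAffine.Nonsingular x y),
      ∃ h', act σ (Affine.Point.some x y h) = Affine.Point.some (σ • x) (σ • y) h')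
    {n : ℕ} {τ : absoluteGaloisGroup ℚ_[2]} (hτ : τ ∈ stab 2 n) {Q : (genFibΩ 2 M).toAffine.Point}
    (hQ : Q ∈ subfieldPoints (genFibΩ 2 M) (layer 2 n).toSubfield coeffs_mem_layer) : act τ Q = Q := by
  rcases Q with _ | ⟨x, y, h⟩
  · exact hact0 τ
  · obtain ⟨hx, hy⟩ := (some_mem_subfieldPoints_iff _ h).mp hQ
    obtain ⟨h', e⟩ := hact τ x y h
    rw [e]
    simp only [smul_eq_self_of_mem_stab hτ hx, smul_eq_self_of_mem_stab hτ hy]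

/-- **Two-term coset sum**: `∑_{q ∈ Stab ζ_{2^m}/Stab ζ_{2^{m+1}}} act q̃ Q = Q + act s Q` for `Q ∈ L(ℚ₂(ζ_{2^{m+1}}))`, `m ≥ 1`,
`s ∈ Stab ζ_{2^m} ∖ Stab ζ_{2^{m+1}}` — the trace of the quadratic step `ℚ₂(ζ_{2^{m+1}}) ⊃ ℚ₂(ζ_{2^m})`. [folklore] -/
theorem sum_act_out_eq_add
    (act : absoluteGaloisGroup ℚ_[2] → (genFibΩ 2 M).toAffine.Point → (genFibΩ 2 M).toAffine.Point)
    (hact0 : ∀ σ, act σ 0 = 0)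
    (hact : ∀ σ (x y : PadicAlgCl 2) (h : (genFibΩ 2 M).toAffine.Nonsingular x y),
      ∃ h', act σ (Affine.Point.some x y h) = Affine.Point.some (σ • x) (σ • y) h')
    {m : ℕ} (hm : 1 ≤ m) [Fintype (stab 2 m ⧸ (stab 2 (m + 1)).subgroupOf (stab 2 m))]
    {s : absoluteGaloisGroup ℚ_[2]} (hs : s ∈ stab 2 m) (hs' : s ∉ stab 2 (m + 1))
    {Q : (genFibΩ 2 M).toAffine.Point} (hQ : Q ∈ subfieldPoints (genFibΩ 2 M) (layer 2 (m + 1)).toSubfield coeffs_mem_layer) :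
    ∑ q : stab 2 m ⧸ (stab 2 (m + 1)).subgroupOf (stab 2 m),
        act ((q.out : stab 2 m) : absoluteGaloisGroup ℚ_[2]) Q = Q + act s Q := by
  rw [sum_out_eq_add hm (fun σ ↦ act σ Q) (fun σ τ hτ ↦ by
    simp only [act_mul act hact0 hact, act_eq_self_of_mem_stab act hact0 hact hτ hQ]) hs hs']
  simp only [act_eq_self_of_mem_stab act hact0 hact (Subgroup.one_mem _) hQ]

end Act

/-! ## §3 The two-term trace relation of the plus Honda points -/

section Trace

variable {M : WeierstrassCurve ℤ_[2]} [hE : (M.map PadicInt.Coe.ringHom).IsElliptic] [hEt : (M.map PadicInt.toZMod).IsElliptic]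
  [hintΩ : (genFibΩ 2 M).IsIntegral (Valued.v (R := PadicAlgCl 2)).integer]

/-- **TWO-TERM TRACE RELATION OF THE PLUS HONDA POINTS** (`p = 2`, `m ≥ 1`, `2 ∣ a₁(M)`, elliptic fibres, `a₂ = 0`): for tower points
`c ∈ L(ℚ₂(ζ_{2^{m+1}})) ∩ E₁`, `c' ∈ L(ℚ₂(ζ_{2^{m−1}})) ∩ E₁` with `Λ = ℓ`, any `σ ∈ Γ` (e.g. the inversion `ι` of file VII) and any
`s ∈ Stab ζ_{2^m} ∖ Stab ζ_{2^{m+1}}`: with `e = c + σ·c`, `e' = c' + σ·c'`,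
**`e + act s e + e' ∈ L(ℚ₂) = E(ℚ₂)`**. (K3 lead's `sum_act_add_sum_act_add_mem_two` with the coset sums evaluated by §2.)
[cite: Kobayashi2003, Lemma 8.9] [cite: KuriharaOtsuki2006, Prop. 1.4] -/
theorem plusPoint_trace (h₁ : M.a₁ ∈ IsLocalRing.maximalIdeal ℤ_[2])
    (act : absoluteGaloisGroup ℚ_[2] → (genFibΩ 2 M).toAffine.Point → (genFibΩ 2 M).toAffine.Point)
    (hact0 : ∀ σ, act σ 0 = 0)
    (hact : ∀ σ (x y : PadicAlgCl 2) (h : (genFibΩ 2 M).toAffine.Nonsingular x y),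
      ∃ h', act σ (Affine.Point.some x y h) = Affine.Point.some (σ • x) (σ • y) h')
    (σ : absoluteGaloisGroup ℚ_[2]) {m : ℕ} (hm : 1 ≤ m)
    {s : absoluteGaloisGroup ℚ_[2]} (hs : s ∈ stab 2 m) (hs' : s ∉ stab 2 (m + 1))
    {c c' : (genFibΩ 2 M).toAffine.Point}
    (hcL : c ∈ subfieldPoints (genFibΩ 2 M) (layer 2 (m + 1)).toSubfield coeffs_mem_layer)
    (hck : c ∈ kernel (Valued.v (R := PadicAlgCl 2)) (genFibΩ 2 M)) (hcℓ : ptLogΩ 2 M c = ell 2 (m + 1))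
    (hc'L : c' ∈ subfieldPoints (genFibΩ 2 M) (layer 2 (m - 1)).toSubfield coeffs_mem_layer)
    (hc'k : c' ∈ kernel (Valued.v (R := PadicAlgCl 2)) (genFibΩ 2 M)) (hc'ℓ : ptLogΩ 2 M c' = ell 2 (m - 1)) :
    (c + act σ c) + act s (c + act σ c) + (c' + act σ c') ∈
      subfieldPoints (genFibΩ 2 M) (layer 2 0).toSubfield coeffs_mem_layer := by
  haveI : ((stab 2 (m + 1)).subgroupOf (stab 2 m)).FiniteIndex :=
    ⟨by rw [index_subgroupOf_stab_succ_two hm]; norm_num⟩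
  haveI : Fintype (stab 2 m ⧸ (stab 2 (m + 1)).subgroupOf (stab 2 m)) := Fintype.ofFinite _
  have h := sum_act_add_sum_act_add_mem_two h₁ act hact0 hact σ hm hcL hck hcℓ hc'L hc'k hc'ℓ
  rw [sum_act_out_eq_add act hact0 hact hm hs hs' hcL,
    sum_act_out_eq_add act hact0 hact hm hs hs' (act_mem_subfieldPoints act hact0 hact σ hcL)] at h
  have e : (c + act σ c) + act s (c + act σ c) + (c' + act σ c') =
      (c + act s c) + (act σ c + act s (act σ c)) + (c' + act σ c') := by
    rw [act_add act hact0 hact]; abel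
  rw [e]
  exact h

end Trace

/-! ## §4 For the curve `W` itself -/

section Curve

variable (W : WeierstrassCurve ℚ) [W.IsElliptic] [W.IsGloballyMinimal]
  [hintΩ : (genFibΩ 2 ((integralModelInt W).map (Int.castRingHom ℤ_[2]))).IsIntegral (Valued.v (R := PadicAlgCl 2)).integer]

/-- **The trace relation of the plus Honda points of `W`** (`GoodSS W 2`, `a₂(W) = 0`): on `M_W`, for tower points `c = c_{m+1}`,
`c' = c_{m−1}` of any family with `Λ = ℓ` (e.g. the family of `exists_plusSystem_of_goodSS`), any `σ` (e.g. `ι`) and any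
`s ∈ Stab ζ_{2^m} ∖ Stab ζ_{2^{m+1}}` (`m ≥ 1`): `(c + σc) + act s (c + σc) + (c' + σc') ∈ E(ℚ₂)` — clause (TR) of HONDA⁺@2 in
`Ω`-currency, two-term form. [cite: Kobayashi2003, Lemma 8.9] -/
theorem plusPoint_trace_of_goodSS (hss : GoodSS W 2) (ha : W.frobeniusTrace 2 = 0)
    (act : absoluteGaloisGroup ℚ_[2] → (genFibΩ 2 ((integralModelInt W).map (Int.castRingHom ℤ_[2]))).toAffine.Point →
      (genFibΩ 2 ((integralModelInt W).map (Int.castRingHom ℤ_[2]))).toAffine.Point)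
    (hact0 : ∀ σ, act σ 0 = 0)
    (hact : ∀ σ (x y : PadicAlgCl 2) (h : (genFibΩ 2 ((integralModelInt W).map (Int.castRingHom ℤ_[2]))).toAffine.Nonsingular x y),
      ∃ h', act σ (Affine.Point.some x y h) = Affine.Point.some (σ • x) (σ • y) h')
    (σ : absoluteGaloisGroup ℚ_[2]) {m : ℕ} (hm : 1 ≤ m)
    {s : absoluteGaloisGroup ℚ_[2]} (hs : s ∈ stab 2 m) (hs' : s ∉ stab 2 (m + 1))
    {c c' : (genFibΩ 2 ((integralModelInt W).map (Int.castRingHom ℤ_[2]))).toAffine.Point}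
    (hcL : c ∈ subfieldPoints (genFibΩ 2 ((integralModelInt W).map (Int.castRingHom ℤ_[2]))) (layer 2 (m + 1)).toSubfield
      coeffs_mem_layer)
    (hck : c ∈ kernel (Valued.v (R := PadicAlgCl 2)) (genFibΩ 2 ((integralModelInt W).map (Int.castRingHom ℤ_[2]))))
    (hcℓ : ptLogΩ 2 ((integralModelInt W).map (Int.castRingHom ℤ_[2])) c = ell 2 (m + 1))
    (hc'L : c' ∈ subfieldPoints (genFibΩ 2 ((integralModelInt W).map (Int.castRingHom ℤ_[2]))) (layer 2 (m - 1)).toSubfield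
      coeffs_mem_layer)
    (hc'k : c' ∈ kernel (Valued.v (R := PadicAlgCl 2)) (genFibΩ 2 ((integralModelInt W).map (Int.castRingHom ℤ_[2]))))
    (hc'ℓ : ptLogΩ 2 ((integralModelInt W).map (Int.castRingHom ℤ_[2])) c' = ell 2 (m - 1)) :
    (c + act σ c) + act s (c + act σ c) + (c' + act σ c') ∈
      subfieldPoints (genFibΩ 2 ((integralModelInt W).map (Int.castRingHom ℤ_[2]))) (layer 2 0).toSubfield coeffs_mem_layer := by
  haveI := isElliptic_coe_twoAdicModel W
  haveI := isElliptic_toZMod_twoAdicModel W hss.1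
  have _htr : Literature.NumberTheory.EllipticCurves.HasseManin.tr
      (((integralModelInt W).map (Int.castRingHom ℤ_[2])).map PadicInt.toZMod) = 0 := by
    rw [tr_twoAdicModel W hss.1, ha]
  exact plusPoint_trace (a₁_twoAdicModel_mem W hss) act hact0 hact σ hm hs hs' hcL hck hcℓ hc'L hc'k hc'ℓ

end Curve

end Summit.BirchSwinnertonDyer.BirchSwinnertonDyer.Theorems.SignedEC.PlusTower

end
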